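import Mathlib
import Summits.Ventures.PercRepro2.Defs
import Summits.Ventures.PercRepro2.Graph
import Summits.Ventures.PercRepro2.OneColourSwitch
import Summits.Ventures.PercRepro2.RegionHubSign
import Summits.Ventures.PercRepro2.SideSwitch
import Summits.Ventures.PercRepro2.SideSwitchFibre
import Summits.Ventures.PercRepro2.SideSwitchClosed
import Summits.Ventures.PercRepro2.SideSwitchComps
import Summits.Ventures.PercRepro2.SideSwitchCompsFibre
import Summits.Ventures.PercRepro2.TermSwitchDefs
import Summits.Ventures.PercRepro2.TermSwitchM9
import Summits.Ventures.PercRepro2.M9NoPocketDefs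
import Summits.Ventures.PercRepro2.M9NoPocketWorld
import Summits.Ventures.PercRepro2.M9NoPocketWorldD
import Summits.Ventures.PercRepro2.M9NoPocketMono
import Summits.Ventures.PercRepro2.M9NoPocketCompl
import Summits.Ventures.PercRepro2.M9DAvoid
import Summits.Ventures.PercRepro2.M9DAvoidSplit
import Summits.Ventures.PercRepro2.M9RegionSplit
import Summits.Ventures.PercRepro2.M9PocketCubeDefs
import Summits.Ventures.PercRepro2.M9PocketCubeMono
import Summits.Ventures.PercRepro2.M9PocketCubeHub
import Summits.Ventures.PercRepro2.M9PocketCubeWorldMono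
import Summits.Ventures.PercRepro2.M9PocketCubeCompl
import Summits.Ventures.PercRepro2.M9SingleDPocket
import Summits.Ventures.PercRepro2.M9DeadEnd

/-!
# Block dead ends along the cube (blind cell PercRepro2, p3 g23, 2026-08-28;
`proofs/P3-HARRIS.md` §10)

A **block dead end** `deadWb`: an `A`-side block vertex (a vertex of the `Y`-world of `{r, s}` in
`G − d`) that is `W`-connected to `d`.  On the block-group cube, below a point with `d ∉ M₂`: a
block dead end persists (`deadWb_assignX_anti`: the `W`-cluster of `d` never meets a `B`-side
vertex or `r, s`, so its `W`-edges are `W` pocket edges, links and edges of `A`-side blocks, all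
`W` downwards), and `DOne` persists (`DOne_assignX_anti_of_not_mem_M2`: a doubly reached vertex
below would be a `B`-side vertex `Y`-connected to `d` through `Y` pocket edges or a current-`Y`
link, all present above).  Own work; std axioms.
-/

namespace Summit.Ventures.PercRepro2

namespace NoPocket

open Finset Classical RegionHub OneColourSwitch SideSwitch TermSwitch

variable {V : Type*} {E : Type*}

section DeadB

variable (ends : E → Sym2 V)

/-- A block dead end of `d`: a vertex of the `Y`-world of `{r, s}` in `G − d`, other than `r, s`,
that is `W`-connected to `d` in `G`. -/
def deadWb (d r s : V) (ω : Config E) : Prop :=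
  ∃ v, v ≠ r ∧ v ≠ s ∧ v ∈ K2 (endsD ends d) r s ω ∧ Conn ends (OneColourSwitch.compl ω) d v

variable {ends}

/-- A block dead end is a dead end. -/
lemma deadW_of_deadWb {d r s : V} (hr : d ≠ r) (hs : d ≠ s) {ω : Config E}
    (h : deadWb ends d r s ω) : deadW ends d r s ω := by
  obtain ⟨v, hvr, hvs, hvK, hc⟩ := h
  have hvd : v ≠ d := by
    rintro rfl
    exact not_mem_K2_endsD hr hs ω hvK
  exact ⟨v, hvr, hvs, hvd, K2_endsD_subset_K2 ω hvK, hc⟩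

end DeadB

section Mono

variable [Fintype V] [DecidableEq V] [Fintype E] [DecidableEq E]

variable {ends : E → Sym2 V}

omit [Fintype V] [DecidableEq V] [Fintype E] [DecidableEq E] in
/-- A vertex `W`-connected to `d` is not in the `W`-world of `{r, s}` when `d` is not. -/
lemma not_mem_M2_of_conn_compl_d {d r s : V} {ω : Config E} (hM : d ∉ M2 ends r s ω) {w : V}
    (hc : Conn ends (OneColourSwitch.compl ω) d w) : w ∉ M2 ends r s ω := by
  intro hw
  apply hM
  rcases mem_M2_iff.1 hw with h | h
  · exact mem_M2_iff.2 (Or.inl (conn_trans h (conn_symm hc)))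
  · exact mem_M2_iff.2 (Or.inr (conn_trans h (conn_symm hc)))

/-- **Block dead ends persist downwards** below a point with `d ∉ M₂`. -/
theorem deadWb_assignX_anti {p q r s d : V} (hr : d ≠ r) (hs : d ≠ s) {ρ : Config E}
    (hρ : ρ ∈ RepP ends p q r s d) {x x' : Finset (Finset V) × Finset E} (hxx' : x' ≤ x)
    (hx : x ∈ cubeP ends d r s ρ) (hx' : x' ∈ cubeP ends d r s ρ)
    (hM : d ∉ M2 ends r s (assignX ends x ρ)) (h : deadWb ends d r s (assignX ends x ρ)) :
    deadWb ends d r s (assignX ends x' ρ) := by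
  obtain ⟨hρD, _⟩ := mem_RepP.1 hρ
  obtain ⟨hT, hF⟩ := mem_cubeP.1 hx
  obtain ⟨hT', hF'⟩ := mem_cubeP.1 hx'
  obtain ⟨v, hvr, hvs, hvK, hc⟩ := h
  refine ⟨v, hvr, hvs, ?_, ?_⟩
  · rw [K2_endsD_assignX' hr hs hρD hT hF] at hvK
    rw [K2_endsD_assignX' hr hs hρD hT' hF']
    exact ⟨hvK.1, fun h' => hvK.2 (Finset.mem_coe.2 (unionT_mono hxx'.1 (Finset.mem_coe.1 h')))⟩
  · -- transfer the `W`-cluster of `d`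
    refine conn_of_le_within (ends := ends) (ω := OneColourSwitch.compl (assignX ends x ρ))
      (S := {w | Conn ends (OneColourSwitch.compl (assignX ends x ρ)) d w}) ?_ ?_
      (conn_refl _ _ _) hc
    · intro y hy z hyz
      obtain ⟨_, e, he, hends⟩ := openGraph_adj.1 hyz
      exact conn_trans hy (conn_of_openAdj ⟨e, he, hends⟩)
    · intro e y z hends hyz hy hz hopen
      have hyM : y ∉ M2 ends r s (assignX ends x ρ) := not_mem_M2_of_conn_compl_d hM hy
      have hzM : z ∉ M2 ends r s (assignX ends x ρ) := not_mem_M2_of_conn_compl_d hM hz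
      have hyr : y ≠ r := by rintro rfl; exact hyM (r_mem_M2 _ _ _)
      have hys : y ≠ s := by rintro rfl; exact hyM (s_mem_M2 _ _ _)
      have hzr : z ≠ r := by rintro rfl; exact hzM (r_mem_M2 _ _ _)
      have hzs : z ≠ s := by rintro rfl; exact hzM (s_mem_M2 _ _ _)
      simp only [OneColourSwitch.compl, Bool.not_eq_true'] at hopen ⊢
      rcases edge_trichotomy hr hs hρD e with hin | ⟨C, hC, w, hw, w', hww'⟩ | hfree
      · exfalso
        obtain ⟨a, ha, b, _, hab⟩ := hin
        rw [hends, Sym2.eq_iff] at hab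
        simp only [Set.mem_insert_iff, Set.mem_singleton_iff] at ha
        rcases hab with ⟨h1, _⟩ | ⟨_, h2⟩
        · rcases ha with rfl | rfl
          · exact hyr h1
          · exact hys h1
        · rcases ha with rfl | rfl
          · exact hzr h2
          · exact hzs h2
      · -- an edge at a block `C`: `C` is `A`-side at `x` (its vertices are not `W`-connected to `d`)
        have hCx : C ∉ x.1 := by
          intro hCx
          have hwM : w ∈ M2 (endsD ends d) r s (assignX ends x ρ) := by
            rw [M2_endsD_assignX' hr hs hρD hT hF]
            exact Or.inr (Finset.mem_coe.2 (mem_unionT.2 ⟨C, hCx, hw⟩))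
          have hwM' : w ∈ M2 ends r s (assignX ends x ρ) := M2_endsD_subset_M2 _ hwM
          -- `w` is an endpoint of `e`, hence in the cluster of `d`
          rw [hends, Sym2.eq_iff] at hww'
          rcases hww' with ⟨h1, _⟩ | ⟨_, h2⟩
          · rw [← h1] at hwM'; exact hyM hwM'
          · rw [← h2] at hwM'; exact hzM hwM'
        rw [assignX_touch_block hρD hT' hF' hr hs hC hw hww', if_neg (fun h' => hCx (hxx'.1 h'))]
        rw [assignX_touch_block hρD hT hF hr hs hC hw hww', if_neg hCx] at hopen
        exact hopen
      · rcases mem_freeE.1 hfree with hTe | hP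
        · exfalso
          rcases mem_Tset.1 hTe with h' | h' <;> rw [hends, Sym2.eq_iff] at h'
          · rcases h' with ⟨_, h2⟩ | ⟨h1, _⟩
            · exact hzr h2
            · exact hyr h1
          · rcases h' with ⟨_, h2⟩ | ⟨h1, _⟩
            · exact hzs h2
            · exact hys h1
        · have hex : e ∉ x.2 := by
            intro hx2
            rw [assignX_Pk_eq_true_of_mem hρ hT hP hx2] at hopen
            exact Bool.noConfusion hopen
          exact assignX_Pk_eq_false_of_notMem hρ hT' hP (fun h' => hex (hxx'.2 h'))

/-- **`DOne` persists downwards** below a point with `d ∉ M₂`. -/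
theorem DOne_assignX_anti_of_not_mem_M2 {p q r s d : V} (hr : d ≠ r) (hs : d ≠ s)
    {ρ : Config E} (hρ : ρ ∈ RepP ends p q r s d) {x x' : Finset (Finset V) × Finset E}
    (hxx' : x' ≤ x) (hx : x ∈ cubeP ends d r s ρ) (hx' : x' ∈ cubeP ends d r s ρ)
    {er : E} (her : ends er = s(d, r)) (hM : d ∉ M2 ends r s (assignX ends x ρ))
    (hD : DOne ends r s d (assignX ends x ρ)) : DOne ends r s d (assignX ends x' ρ) := by
  obtain ⟨hρD, _⟩ := mem_RepP.1 hρ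
  obtain ⟨hT, hF⟩ := mem_cubeP.1 hx
  obtain ⟨hT', hF'⟩ := mem_cubeP.1 hx'
  have hM' : d ∉ M2 ends r s (assignX ends x' ρ) :=
    fun h' => hM (mem_M2_assignX_mono hr hs hρ hxx' hx' hx h')
  intro v hvr hvs hvd hvK hvM
  -- `v` is a `B`-side block vertex at `x'` (hence at `x`)
  have hvM' : v ∈ M2 (endsD ends d) r s (assignX ends x' ρ) := by
    rw [← K2_compl]
    have hrd : ¬ Conn ends (OneColourSwitch.compl (assignX ends x' ρ)) r d :=
      fun h' => hM' (mem_M2_iff.2 (Or.inl h'))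
    have hsd : ¬ Conn ends (OneColourSwitch.compl (assignX ends x' ρ)) s d :=
      fun h' => hM' (mem_M2_iff.2 (Or.inr h'))
    rcases mem_M2_iff.1 hvM with h' | h'
    · exact mem_K2_iff.2 (Or.inl (conn_endsD_of_not_conn h' hrd))
    · exact mem_K2_iff.2 (Or.inr (conn_endsD_of_not_conn h' hsd))
  have hvT' : v ∈ unionT x'.1 := by
    rw [M2_endsD_assignX' hr hs hρD hT' hF'] at hvM'
    obtain ⟨_, hMρ, _⟩ := mem_RepD.1 hρD
    rcases hvM' with h' | h'
    · rcases hMρ v h' with h'' | h''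
      · exact (hvr h'').elim
      · exact (hvs h'').elim
    · exact Finset.mem_coe.1 h'
  have hvMx : v ∈ M2 ends r s (assignX ends x ρ) := by
    refine M2_endsD_subset_M2 (d := d) _ ?_
    rw [M2_endsD_assignX' hr hs hρD hT hF]
    exact Or.inr (Finset.mem_coe.2 (unionT_mono hxx'.1 hvT'))
  have hvK' : v ∉ K2 (endsD ends d) r s (assignX ends x' ρ) := by
    rw [K2_endsD_assignX' hr hs hρD hT' hF']
    exact fun h' => h'.2 (Finset.mem_coe.2 hvT')
  -- `v ∈ K₂(x′)` must go through `d`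
  have hdv : Conn ends (assignX ends x' ρ) d v := by
    rcases mem_K2_iff.1 hvK with h' | h'
    · by_cases hrd : Conn ends (assignX ends x' ρ) r d
      · exact conn_trans (conn_symm hrd) h'
      · exact (hvK' (mem_K2_iff.2 (Or.inl (conn_endsD_of_not_conn h' hrd)))).elim
    · by_cases hsd : Conn ends (assignX ends x' ρ) s d
      · exact conn_trans (conn_symm hsd) h'
      · exact (hvK' (mem_K2_iff.2 (Or.inr (conn_endsD_of_not_conn h' hsd)))).elim
  obtain ⟨e, u, hends, he, hcu⟩ :=
    conn_d_decomp (ends := ends) (ω := assignX ends x' ρ) (a := v) hvd (conn_symm hdv)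
  -- the first edge `d–u` and the `G − d` path `v ~ u` survive at `x`
  have hud : u ≠ d := ne_d_of_conn_endsD hvd hcu
  have huK' : u ∉ K2 (endsD ends d) r s (assignX ends x' ρ) :=
    not_mem_K2_endsD_of_conn hvK' hcu
  have hur : u ≠ r := by rintro rfl; exact huK' (r_mem_K2 _ _ _)
  have hus : u ≠ s := by rintro rfl; exact huK' (s_mem_K2 _ _ _)
  have hcu' : Conn (endsD ends d) (assignX ends x ρ) v u :=
    conn_endsD_assignX_mono hr hs hρ hxx' hx' hx hvK' hcu
  have he' : assignX ends x ρ e = true := by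
    rcases mem_Oprime_or_block (ends := ends) (d := d) ρ hur hus with hu | ⟨C, hC, huC⟩
    · have hP : e ∈ Pk ends d r s ρ := mem_Pk_of_mem_Oprime hr hs hu hends
      have hex : e ∈ x'.2 := by
        by_contra hx2
        rw [assignX_Pk_eq_false_of_notMem hρ hT' hP hx2] at he
        exact Bool.noConfusion he
      exact assignX_Pk_eq_true_of_mem hρ hT hP (hxx'.2 hex)
    · have hCx : C ∈ x'.1 := by
        by_contra hCx
        apply huK'
        rw [K2_endsD_assignX' hr hs hρD hT' hF']
        exact ⟨mem_K2_endsD_of_block hρD hC huC, fun h' =>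
          hCx (block_mem_of_mem_unionT hρD hT' hC huC (Finset.mem_coe.1 h'))⟩
      rw [assignX_block_edge' hρD hT hF hr hs hC huC hends, if_pos (hxx'.1 hCx)]
      rw [assignX_block_edge' hρD hT' hF' hr hs hC huC hends, if_pos hCx] at he
      exact he
  have hdvx : Conn ends (assignX ends x ρ) d v :=
    conn_trans (conn_of_openAdj ⟨e, he', hends⟩) (conn_symm (conn_of_conn_endsD hcu'))
  have hrd : Conn ends (assignX ends x ρ) d r := conn_of_edge_of_not_mem_M2 hM (Or.inl rfl) her
  exact hD v hvr hvs hvd (mem_K2_iff.2 (Or.inl (conn_trans (conn_symm hrd) hdvx))) hvMx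

end Mono

end NoPocket

end Summit.Ventures.PercRepro2
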